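import Literature.Analysis.DeBrangesSpaces.ConreyLi2000Theorem2Proofs
import HarnessLib

/-!
# The Poisson integral of `log|P|` for a complex polynomial `P` (Rudin 17.16–17.17, half-plane)

LABEL (line 1): RH-FREE folklore complex analysis; tooling for the membership inequalities of the
de Branges / Conrey–Li spaces (`Literature/Analysis/DeBrangesSpaces/ConreyLi2000SpacesFW.lean`).
bears_on: B-C/B-P (LADDER-RH §1, COLUMN 6 DBR) as infrastructure only. WHAT THIS IS NOT: nothing
here concerns `ζ` or its zeros; nothing here bears on the truth of RH.

For a nonzero polynomial `P ∈ ℂ[X]` with leading coefficient `lc`, distinct roots `ρ` of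
multiplicities `m_ρ`, and `z = x + iy` with `y > 0`:

* `integral_log_norm_eval`: `t ↦ log|P(t)|/((t−x)²+y²)` is integrable over `ℝ` and
  `∫ log|P(t)| dt/((t−x)²+y²) = (π/y) log|lc| + Σ_ρ m_ρ ∫ log|t − ρ| dt/((t−x)²+y²)`
  (the boundary function differs from the root expansion only on the finite set of real roots);
* `pi_div_mul_log_norm_eval_le`: **`(π/y) log|P(z)| ≤ ∫ log|P(t)| dt/((t−x)²+y²)`** for
  `P(z) ≠ 0` — the half-plane, polynomial form of Rudin's inequality
  `log|f(0)| ≤ (1/2π)∫ log|f*(e^{it})| dt` (*Real and Complex Analysis*, Thm 17.17 (3)), root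
  by root from `log_norm_sub_le_poisson` (every root, real ones included; file
  `ConreyLi2000Theorem2Proofs.lean`);
* `integral_log_norm_eval_of_roots_im_neg`: **equality** when every root lies in the open lower
  half-plane (`P` outer for the upper half-plane; Rudin Thm 17.16 (a)), from the tree's
  `integral_log_norm_sub_div` (`PoissonLogModulus.lean`).

These generalise the in-proof computation `SpaceF.poissonLogMajorant_sum_q` of
`ConreyLi2000Theorem2Proofs.lean` (which treats the specific partial-fraction numerator of a finite
kernel combination) to an arbitrary complex polynomial, via the fundamental theorem of algebra
(`Polynomial.Splits.eq_prod_roots`, `Polynomial.prod_multiset_root_eq_finset_root`). Provenance: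
the banked Brick B of the `conreyLi2000_thm2` discharge (rh-crit dbl row R3, 2026-08-26), §B.

## References

* [Rudin1987] W. Rudin, *Real and Complex Analysis*, 3rd ed., Thm 17.16 (a) (outer functions:
  `log|Q|` is the Poisson integral of its boundary values) and Thm 17.17 (3)
  (`log|f(0)| ≤ (1/2π)∫ log|f*|`), read in the held copy pp. 282–284; half-plane polynomial forms.
* [ConreyLi2000] J. B. Conrey, X.-J. Li, IMRN 2000:18 = arXiv:math/9812166, §2 (the membership
  inequality of `𝓕(W)` that these lemmas serve).
-/

noncomputable section

open scoped Real Topology ComplexConjugate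
open _root_.Complex _root_.MeasureTheory _root_.Filter _root_.Set
open Polynomial

namespace Literature.Analysis.DeBrangesSpaces

/-! ### `log|P(u)|` through the roots, and its Poisson integral -/

/-- Factorisation over `ℂ`: `P = lc(P) · ∏_{ρ} (X − ρ)^{m_ρ}` over the distinct roots. [folklore] -/
private theorem eq_C_mul_prod_pow (P : ℂ[X]) :
    P = C P.leadingCoeff * ∏ ρ ∈ P.roots.toFinset, (X - C ρ) ^ P.rootMultiplicity ρ := by
  classical
  conv_lhs => rw [Polynomial.Splits.eq_prod_roots (IsAlgClosed.splits P),
    Polynomial.prod_multiset_root_eq_finset_root]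

/-- `P(u) = lc(P) · ∏_{ρ} (u − ρ)^{m_ρ}`. [folklore] -/
private theorem eval_eq_lc_mul_prod (P : ℂ[X]) (u : ℂ) :
    P.eval u = P.leadingCoeff * ∏ ρ ∈ P.roots.toFinset, (u - ρ) ^ P.rootMultiplicity ρ := by
  classical
  conv_lhs => rw [eq_C_mul_prod_pow P]
  rw [eval_mul, eval_C, eval_prod]
  simp only [eval_pow, eval_sub, eval_X, eval_C]

/-- **`log|P(u)| = log|lc(P)| + ∑_ρ m_ρ log|u − ρ|`** at a non-root `u` of a nonzero complex
polynomial `P` (sum over the distinct roots `ρ`, multiplicities `m_ρ`). [folklore] -/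
private theorem log_norm_eval_eq_sum {P : ℂ[X]} (hP : P ≠ 0) {u : ℂ} (hu : P.eval u ≠ 0) :
    Real.log ‖P.eval u‖ = Real.log ‖P.leadingCoeff‖
      + ∑ ρ ∈ P.roots.toFinset, (P.rootMultiplicity ρ : ℝ) * Real.log ‖u - ρ‖ := by
  classical
  have hlc : P.leadingCoeff ≠ 0 := leadingCoeff_ne_zero.2 hP
  have hfac : ∀ ρ ∈ P.roots.toFinset, ‖u - ρ‖ ^ P.rootMultiplicity ρ ≠ 0 := by
    intro ρ hρ
    apply pow_ne_zero
    rw [norm_ne_zero_iff, sub_ne_zero]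
    rintro rfl
    rw [Multiset.mem_toFinset, mem_roots hP] at hρ
    exact hu hρ
  rw [eval_eq_lc_mul_prod P u, norm_mul, norm_prod, Real.log_mul (norm_ne_zero_iff.2 hlc)
    (Finset.prod_ne_zero_iff.2 (fun ρ hρ ↦ by rw [norm_pow]; exact hfac ρ hρ))]
  congr 1
  rw [Real.log_prod]
  · refine Finset.sum_congr rfl fun ρ _ ↦ ?_
    rw [norm_pow, Real.log_pow]
  · intro ρ hρ
    rw [norm_pow]
    exact hfac ρ hρ

/-- The real roots of a nonzero complex polynomial form a finite set. [folklore] -/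
private theorem finite_real_roots {P : ℂ[X]} (hP : P ≠ 0) :
    {t : ℝ | P.eval (t : ℂ) = 0}.Finite := by
  have h : {t : ℝ | P.eval (t : ℂ) = 0} = ((↑) : ℝ → ℂ) ⁻¹' (P.roots.toFinset : Set ℂ) := by
    ext t
    simp [Polynomial.mem_roots hP]
  rw [h]
  exact (P.roots.toFinset.finite_toSet).preimage (Complex.ofReal_injective.injOn)


/-- **Poisson integral of `log|P(t)|` for a nonzero complex polynomial**: for `y > 0`,
`t ↦ log|P(t)|/((t−x)²+y²)` is integrable over `ℝ` and
`∫ log|P(t)| dt/((t−x)²+y²) = (π/y) log|lc(P)| + ∑_ρ m_ρ ∫ log|t − ρ| dt/((t−x)²+y²)`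
(the boundary function differs from the root expansion only on the finite set of real roots).
[cite: Rudin1987, Thm 17.17 (half-plane form, polynomial `f`)] -/
theorem integral_log_norm_eval {P : ℂ[X]} (hP : P ≠ 0) (x : ℝ) {y : ℝ} (hy : 0 < y) :
    Integrable (fun t : ℝ ↦ Real.log ‖P.eval (t : ℂ)‖ / ((t - x) ^ 2 + y ^ 2)) ∧
      ∫ t : ℝ, Real.log ‖P.eval (t : ℂ)‖ / ((t - x) ^ 2 + y ^ 2)
        = π / y * Real.log ‖P.leadingCoeff‖
          + ∑ ρ ∈ P.roots.toFinset, (P.rootMultiplicity ρ : ℝ)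
              * ∫ t : ℝ, Real.log ‖(t : ℂ) - ρ‖ / ((t - x) ^ 2 + y ^ 2) := by
  classical
  set S := P.roots.toFinset with hS
  -- the model integrand
  set M : ℝ → ℝ := fun t ↦ Real.log ‖P.leadingCoeff‖ * ((t - x) ^ 2 + y ^ 2)⁻¹
    + ∑ ρ ∈ S, (P.rootMultiplicity ρ : ℝ) * (Real.log ‖(t : ℂ) - ρ‖ / ((t - x) ^ 2 + y ^ 2))
    with hM
  have hMint : Integrable M := by
    refine ((integrable_inv_sub_sq_add_sq x hy.ne').const_mul _).add ?_
    exact integrable_finsetSum S fun ρ _ ↦ (integrable_log_norm_sub_div' ρ x hy.ne').const_mul _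
  have hae : (fun t : ℝ ↦ Real.log ‖P.eval (t : ℂ)‖ / ((t - x) ^ 2 + y ^ 2)) =ᵐ[volume] M := by
    have h0 : ∀ᵐ t : ℝ, t ∉ {t : ℝ | P.eval (t : ℂ) = 0} :=
      measure_eq_zero_iff_ae_notMem.1 ((finite_real_roots hP).measure_zero volume)
    filter_upwards [h0] with t ht
    have ht' : P.eval (t : ℂ) ≠ 0 := ht
    rw [log_norm_eval_eq_sum hP ht', hM, hS]
    simp only [div_eq_mul_inv]
    rw [add_mul, Finset.sum_mul]
    congr 1
    exact Finset.sum_congr rfl fun ρ _ ↦ by ring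
  refine ⟨hMint.congr hae.symm, ?_⟩
  rw [integral_congr_ae hae, hM]
  simp only
  rw [integral_add ((integrable_inv_sub_sq_add_sq x hy.ne').const_mul _)
      (integrable_finsetSum S fun ρ _ ↦ (integrable_log_norm_sub_div' ρ x hy.ne').const_mul _),
    integral_const_mul, integral_inv_sub_sq_add_sq x hy,
    integral_finsetSum S fun ρ _ ↦ (integrable_log_norm_sub_div' ρ x hy.ne').const_mul _]
  congr 1
  · ring
  · exact Finset.sum_congr rfl fun ρ _ ↦ integral_const_mul _ _

/-- **`log|P(z)| ≤ Poisson integral of `log|P|`**: for a nonzero complex polynomial `P` and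
`z = x + iy`, `y > 0`, with `P(z) ≠ 0`:
`(π/y) log|P(z)| ≤ ∫ log|P(t)| dt/((t−x)²+y²)` — the half-plane form of Rudin's inequality
`log|f(0)| ≤ (1/2π)∫ log|f*|` (17.17 (3)) for polynomial `f`.
[cite: Rudin1987, Thm 17.17 (3) (half-plane form, polynomial `f`)] -/
theorem pi_div_mul_log_norm_eval_le {P : ℂ[X]} (hP : P ≠ 0) (x : ℝ) {y : ℝ} (hy : 0 < y)
    (hz : P.eval ((x : ℂ) + y * I) ≠ 0) :
    π / y * Real.log ‖P.eval ((x : ℂ) + y * I)‖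
      ≤ ∫ t : ℝ, Real.log ‖P.eval (t : ℂ)‖ / ((t - x) ^ 2 + y ^ 2) := by
  classical
  rw [(integral_log_norm_eval hP x hy).2, log_norm_eval_eq_sum hP hz, mul_add, Finset.mul_sum]
  refine add_le_add le_rfl (Finset.sum_le_sum fun ρ hρ ↦ ?_)
  rw [← mul_assoc, mul_comm (π / y), mul_assoc]
  refine mul_le_mul_of_nonneg_left ?_ (Nat.cast_nonneg _)
  · have hzρ : (x : ℂ) + y * I ≠ ρ := by
      rintro h
      rw [Multiset.mem_toFinset, mem_roots hP] at hρ
      exact hz (h ▸ hρ)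
    have h := (log_norm_sub_le_poisson ρ x hy hzρ).2
    have hπy : 0 < π / y := by positivity
    have key : π / y * (y / π) = 1 := by field_simp
    calc π / y * Real.log ‖(x : ℂ) + y * I - ρ‖
        ≤ π / y * (y / π * ∫ t : ℝ, Real.log ‖(t : ℂ) - ρ‖ / ((t - x) ^ 2 + y ^ 2)) :=
          mul_le_mul_of_nonneg_left h hπy.le
      _ = ∫ t : ℝ, Real.log ‖(t : ℂ) - ρ‖ / ((t - x) ^ 2 + y ^ 2) := by
          rw [← mul_assoc, key, one_mul]

/-- **`log|P(z)| = Poisson integral of `log|P|`** when all roots of `P` lie in the open LOWER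
half-plane (`P` outer for the upper half-plane): for `z = x + iy`, `y > 0`,
`∫ log|P(t)| dt/((t−x)²+y²) = (π/y) log|P(z)|`.
[cite: Rudin1987, Thm 17.16 (a) (half-plane form, outer polynomial)] -/
theorem integral_log_norm_eval_of_roots_im_neg {P : ℂ[X]} (hP : P ≠ 0)
    (hroots : ∀ ρ ∈ P.roots, ρ.im < 0) (x : ℝ) {y : ℝ} (hy : 0 < y) :
    ∫ t : ℝ, Real.log ‖P.eval (t : ℂ)‖ / ((t - x) ^ 2 + y ^ 2)
      = π / y * Real.log ‖P.eval ((x : ℂ) + y * I)‖ := by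
  classical
  have hz : P.eval ((x : ℂ) + y * I) ≠ 0 := by
    intro h
    have := hroots _ ((mem_roots hP).2 h)
    simp at this
    linarith
  rw [(integral_log_norm_eval hP x hy).2, log_norm_eval_eq_sum hP hz, mul_add, Finset.mul_sum]
  congr 1
  refine Finset.sum_congr rfl fun ρ hρ ↦ ?_
  rw [integral_log_norm_sub_div (hroots ρ (Multiset.mem_toFinset.1 hρ)) x hy]
  ring


end Literature.Analysis.DeBrangesSpaces

end
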